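import Summits.QuantumAdvantage.QuantumAdvantage.Theses.ArithStatLadder
import Literature.Computability.MetaComplexity.HeuristicClassesProofs
import Literature.Computability.Complexity.PCPProofs
import Literature.Computability.Complexity.RandomizedProofs

/-!
# Negative-side lemmas for the crux `ArithStatLadder.AvgFaceBeyondPrior` (stmt-QuantumAdvantage-2427)

Supporting (negative-lane) facts from the standing disprover's work file
`Cruxes/AvgFaceBeyondPrior/Disproof.lean` (cdisprove seat, 2026-08-16). None of them asserts a
Theses decl positively. The crux is `(IQ3, U) ∉ Heur_{1/3}BPP` with `IQ3 = {bin d : −d fundamental,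
3 ∣ h(−d)}` and `Uₙ` uniform on the n-bit `d` with `−d` fundamental.

* `avgFace_iff` — the crux unfolded: every PPT `A(x, 1ⁿ)` has bad `Uₙ`-mass `> 1/3` at some `n`.
* `avgFaceBeyondPrior_false_without_PPT` — dropping polynomial time makes it false (truth table): any proof
  must use `IsPolyTime`.
* `avgFaceBeyondPrior_false_at_delta_one`, `not_mem_HeurDeltaBPP_of_neg`, `not_mem_HeurDeltaBPP_anti`
  — the δ-axis: the family `(IQ3,U) ∉ Heur_δBPP` is antitone, trivially true for `δ < 0`, false at
  `δ = 1`; the crux is `δ = 1/3` (Cohen–Lenstra put the flip at `0.43987`).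
* Companion files: `AvgFaceBeyondPriorBlocks.lean` (the dyadic blocks of fundamental discriminants:
  nonempty from `n = 2`, at most a third of the block from `n = 5`) and
  `AvgFaceBeyondPriorConditioning.lean` (on UNIFORM n-bit integers the `δ = 1/3` face is false:
  the conditioning on fundamental discriminants is load-bearing).
* `avgFace_imp_exists_level` — NECESSARY CONDITION: the crux forces a level `n` with
  `#fundBlock n < 3 · #{d ∈ fundBlock n | 3 ∣ h(−d)}` (the constant predictor `3 ∤ h` must be bad
  somewhere); true numerically, not a theorem of the tree — a proof of the crux certifies it.
* `mem_HeurDeltaBPP_of_mem_BPP` — `(BPP, 𝒟) ⊆ Heur_δBPP` for every ensemble and `δ ≥ 0`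
  (parameter-dropping lift `paramLift`, as the tree's `schemeLift`); hence
  `avgFace_imp_not_mem_BPP` (the crux is at least the worst-case separation `IQ3 ∉ BPP`, so the
  barrier `SeparationPrerequisites` applies to it) and `not_avgFace_of_not_summit`
  (with `IqThreeMemBQP`, `¬summit ⇒ ¬crux`; forwards: the support item is assembly-grade).
-/


namespace Summit.QuantumAdvantage.QuantumAdvantage.Theorems.AvgFaceBeyondPrior.Negative

open _root_.Computability
open Literature.Computability.Complexity Literature.Computability.MetaComplexity
open Literature.NumberTheory.QuadraticFields
open Summit.QuantumAdvantage.QuantumAdvantage.Theses.ArithStatLadder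
open scoped Classical ENNReal

/-! ## §1 Semantics: names for the pieces of the crux and the unfolded statement -/

/-- The set `IQ3 ⊆ ℕ`: `−d` fundamental and `3 ∣ h(−d)` (literal copy of the route's set). [folklore] -/
def iq3Set : Set ℕ :=
  {d : ℕ | (((-(d:ℤ)) % 4 = 1 ∧ Squarefree (-(d:ℤ)) ∧ (-(d:ℤ)) ≠ 1) ∨ (4 ∣ (-(d:ℤ)) ∧ ((-(d:ℤ)) / 4 % 4 = 2 ∨ (-(d:ℤ)) / 4 % 4 = 3) ∧ Squarefree ((-(d:ℤ)) / 4))) ∧ 3 ∣ Literature.NumberTheory.QuadraticFields.BinaryQuadraticForm.classNumber (-(d:ℤ))}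

/-- The language `IQ3 ⊆ {0,1}*` (LSB-first binary); typed as a `Set` so that `∈` is `Set`'s. [folklore] -/
def iq3Lang : Set (List Bool) := encodingNatBool.toLanguage iq3Set

/-- The dyadic block of n-bit `d` with `−d` fundamental (literal copy of the route's finset). [folklore] -/
noncomputable def fundBlock (n : ℕ) : Finset ℕ :=
  (Finset.Ico (2 ^ (n - 1)) (2 ^ n)).filter (fun d : ℕ => (((-(d:ℤ)) % 4 = 1 ∧ Squarefree (-(d:ℤ)) ∧ (-(d:ℤ)) ≠ 1) ∨ (4 ∣ (-(d:ℤ)) ∧ ((-(d:ℤ)) / 4 % 4 = 2 ∨ (-(d:ℤ)) / 4 % 4 = 3) ∧ Squarefree ((-(d:ℤ)) / 4))))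

/-- The ensemble `U`: uniform on `fundBlock n` (pushed to strings), `pure []` if empty. [folklore] -/
noncomputable def ens : Ensemble := fun n =>
  if h : (fundBlock n).Nonempty then (PMF.uniformOfFinset (fundBlock n) h).map encodeNat
  else PMF.pure []

/-- The distributional problem `(IQ3, U)` of the crux. [folklore] -/
noncomputable def Q : DistProblem := ⟨iq3Lang, ens⟩

/-- The crux is literally `Q ∉ Heur_{1/3}BPP` (definitional). [folklore] -/
theorem avgFace_iff_Q : AvgFaceBeyondPrior ↔ Q ∉ HeurDeltaBPP (fun _ => (1:ℝ) / 3) := Iff.rfl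

/-- **The crux unfolded**: every PPT `A(x, 1ⁿ)` has, at some level `n`, bad mass `> 1/3`
(bad = coin error `≥ 1/4`). [cite: BogdanovTrevisan2006, Def. 2.13] -/
theorem avgFace_iff :
    AvgFaceBeyondPrior ↔ ∀ A : RandAlg (List Bool × ℕ) Bool, A.IsPolyTime paramEnc encodeBool →
      ∃ n, (1:ℝ) / 3 < ens.prob n
        {x | 1 / 4 ≤ A.pr paramEnc (x, n) {b | b ≠ iq3Lang.boolIndicator x}} := by
  rw [avgFace_iff_Q]
  simp only [HeurDeltaBPP, Set.mem_setOf_eq, not_exists, not_and, not_forall, not_le]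
  rfl

/-- `encodeNat 0 = []`. [folklore] -/
theorem encodeNat_zero : encodeNat 0 = [] := by decide

/-- `0 ∉ IQ3` (`0` is not a discriminant of the right shape). [folklore] -/
theorem zero_not_mem_iq3Set : (0 : ℕ) ∉ iq3Set := by
  rintro ⟨h | h, -⟩
  · norm_num at h
  · norm_num at h

/-- The empty string is not in `IQ3` (it encodes `0`), so the `pure []` branch of `U` (levels
`n ≤ 1`) never makes an algorithm that answers `false` there bad. [folklore] -/
theorem nil_not_mem_iq3Lang : ([] : List Bool) ∉ iq3Lang := by
  intro h
  rw [← encodeNat_zero] at h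
  exact zero_not_mem_iq3Set ((encodingNatBool.mem_toLanguage_iff iq3Set 0).1 h)

/-- Membership of a code word in `IQ3`. [folklore] -/
theorem encodeNat_mem_iq3Lang (d : ℕ) : encodeNat d ∈ iq3Lang ↔ d ∈ iq3Set :=
  encodingNatBool.mem_toLanguage_iff iq3Set d

/-- **Bad mass is a counting ratio**: on a nonempty block, the `Uₙ`-probability of an event is
`#{d ∈ fundBlock n | bin d ∈ E} / #fundBlock n`. [folklore] -/
theorem ens_prob_eq {n : ℕ} (h : (fundBlock n).Nonempty) (E : Set (List Bool)) :
    ens.prob n E = (((fundBlock n).filter fun d => encodeNat d ∈ E).card : ℝ) / (fundBlock n).card := by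
  unfold Ensemble.prob ens
  rw [dif_pos h, PMF.toOuterMeasure_map_apply, PMF.toOuterMeasure_uniformOfFinset_apply,
    ENNReal.toReal_div]
  simp only [Set.mem_preimage, ENNReal.toReal_natCast]

/-- On an empty block the ensemble is the point mass at `[]`. [folklore] -/
theorem ens_prob_of_not_nonempty {n : ℕ} (h : ¬ (fundBlock n).Nonempty) (E : Set (List Bool)) :
    ens.prob n E = if ([] : List Bool) ∈ E then 1 else 0 := by
  unfold Ensemble.prob ens
  rw [dif_neg h, PMF.toOuterMeasure_pure_apply]
  split_ifs <;> simp

/-! ## §2 Load-bearing analysis -/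

/-- The δ-axis (the crux is `δ = 1/3` of the family `Q ∉ Heur_δBPP`, antitone in `δ`): a smaller
`δ` is a weaker hardness claim. [folklore] -/
theorem not_mem_HeurDeltaBPP_anti {δ δ' : ℝ} (hle : δ ≤ δ') (h : Q ∉ HeurDeltaBPP (fun _ => δ')) :
    Q ∉ HeurDeltaBPP (fun _ => δ) := by
  rintro ⟨A, hA, hgood⟩
  exact h ⟨A, hA, fun n => (hgood n).trans hle⟩

/-- Trivial truth region of the δ-axis: for `δ < 0` the class `Heur_δBPP` is empty. [folklore] -/
theorem not_mem_HeurDeltaBPP_of_neg {δ : ℝ} (hδ : δ < 0) : Q ∉ HeurDeltaBPP (fun _ => δ) := by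
  rintro ⟨A, -, hgood⟩
  exact absurd ((Ensemble.prob_nonneg _ _ _).trans (hgood 0)) (not_le.2 hδ)

/-- The constant-`false` PPT algorithm on parametrised inputs. [folklore] -/
def constFalse : RandAlg (List Bool × ℕ) Bool := RandAlg.ofDet fun _ => false

/-- It is PPT (`PolyTimeComputable.const` + `IsPolyTime.ofDet_holds`). [folklore] -/
theorem isPolyTime_constFalse : constFalse.IsPolyTime paramEnc encodeBool :=
  RandAlg.IsPolyTime.ofDet_holds (PolyTimeComputable.const paramEnc encodeBool false)

/-- **Trivial falsity region (tightness of the δ-axis at the top)**: at `δ = 1` the problem IS in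
the class (any PPT algorithm; bad mass is a probability). So the family flips somewhere in
`[0, 1]`; Cohen–Lenstra (C2) put the flip at `δ* = 0.43987` (constant predictor `3 ∤ h`). [folklore] -/
theorem avgFaceBeyondPrior_false_at_delta_one : Q ∈ HeurDeltaBPP (fun _ => (1:ℝ)) :=
  ⟨constFalse, isPolyTime_constFalse, fun _ => Ensemble.prob_le_one _ _ _⟩

/-- **Polynomial time is the whole content** (the crux WITHOUT the efficiency restriction is
false): information-theoretically the truth table has bad mass `0` at every level, so it is not the
case that every function `A(x, n)` has bad mass `> 1/3` somewhere. Any proof of the crux must use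
`IsPolyTime`. [folklore] -/
theorem avgFaceBeyondPrior_false_without_PPT :
    ¬ ∀ A : List Bool × ℕ → Bool, ∃ n,
      (1:ℝ) / 3 < ens.prob n {x | A (x, n) ≠ iq3Lang.boolIndicator x} := by
  intro h
  obtain ⟨n, hn⟩ := h fun p => iq3Lang.boolIndicator p.1
  have h0 : {x : List Bool | iq3Lang.boolIndicator x ≠ iq3Lang.boolIndicator x} = ∅ := by
    ext x; simp
  rw [h0, Ensemble.prob, MeasureTheory.measure_empty, ENNReal.toReal_zero] at hn
  norm_num at hn

/-! ## §3 Necessary condition: the constant predictor must be bad at some level -/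

/-- The bad set of the constant-`false` algorithm is exactly the language. [folklore] -/
theorem badSet_constFalse (n : ℕ) :
    {x | (1:ℝ) / 4 ≤ constFalse.pr paramEnc (x, n) {b | b ≠ iq3Lang.boolIndicator x}} = iq3Lang := by
  ext x
  simp only [Set.mem_setOf_eq, constFalse, RandAlg.pr_ofDet, ne_eq]
  by_cases hx : x ∈ iq3Lang
  · have hi := (Set.mem_iff_boolIndicator (s := iq3Lang) x).1 hx
    simp only [hi, Bool.false_eq_true, not_false_eq_true, if_true]
    exact iff_of_true (by norm_num) hx
  · have hi := (Set.notMem_iff_boolIndicator (s := iq3Lang) x).1 hx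
    simp only [hi, not_true_eq_false, if_false]
    exact iff_of_false (by norm_num) hx

/-- **Necessary condition for the crux** (unconditional): if `AvgFaceBeyondPrior` holds then at
SOME level `n` more than a third of the n-bit fundamental discriminants `−d` have `3 ∣ h(−d)`:
`#fundBlock n < 3 · #{d ∈ fundBlock n | 3 ∣ h(−d)}`. (Apply the crux to the constant predictor
`3 ∤ h`; its bad set is `IQ3`; the `pure []` levels give mass `0`.) Cohen–Lenstra predict the
proportion tends to `0.43987 > 1/3`, and PARI finds the first such level at small `n` (§4), but
no theorem of the tree proves it for any `n`: a Lean proof of the crux certifies this instance of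
arithmetic statistics on the way. [cite: CohenLenstra1984, §9 (C2)] -/
theorem avgFace_imp_exists_level (h : AvgFaceBeyondPrior) :
    ∃ n, (fundBlock n).Nonempty ∧
      ((fundBlock n).card : ℝ) <
        3 * ((fundBlock n).filter fun d : ℕ => 3 ∣ BinaryQuadraticForm.classNumber (-(d:ℤ))).card := by
  obtain ⟨n, hn⟩ := (avgFace_iff.1 h) constFalse isPolyTime_constFalse
  rw [badSet_constFalse] at hn
  by_cases hne : (fundBlock n).Nonempty
  · refine ⟨n, hne, ?_⟩
    rw [ens_prob_eq hne] at hn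
    have hcard : (0:ℝ) < (fundBlock n).card := by exact_mod_cast hne.card_pos
    rw [lt_div_iff₀ hcard] at hn
    have hfilter : ((fundBlock n).filter fun d => encodeNat d ∈ iq3Lang) =
        (fundBlock n).filter fun d : ℕ => 3 ∣ BinaryQuadraticForm.classNumber (-(d:ℤ)) := by
      refine Finset.filter_congr fun d hd => ?_
      rw [encodeNat_mem_iq3Lang]
      exact ⟨fun h => h.2, fun h => ⟨(Finset.mem_filter.1 hd).2, h⟩⟩
    rw [hfilter] at hn
    linarith
  · rw [ens_prob_of_not_nonempty hne, if_neg nil_not_mem_iq3Lang] at hn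
    norm_num at hn

/-! ## §3' Barrier reduction: the crux implies the worst-case lower bound `IQ3 ∉ BPP` -/

section ParamLift

variable {β Γ₁ : Type}

/-- Lift of a randomized algorithm on strings to parametrised inputs `(x, 1ⁿ)`, ignoring `n`.
[cite: BogdanovTrevisan2006, §2.3] -/
def paramLift (A : RandAlg (List Bool) β) : RandAlg (List Bool × ℕ) β where
  run q r := A.run q.1 r
  coinLen := A.coinLen

/-- The sample is no longer than the parametrised input. [folklore] -/
theorem length_le_length_paramEnc (x : List Bool) (n : ℕ) :
    x.length ≤ (paramEnc (x, n)).length := by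
  simp only [paramEnc, length_boolPair]
  omega

/-- Output distribution of the lift = that of `A` on `x` (coin-oblivious `A`, exactly polynomial
budget), as `outputPMF_schemeLift`. [cite: BogdanovTrevisan2006, §2.3] -/
theorem outputPMF_paramLift (A : RandAlg (List Bool) β)
    (hq : ∃ q : Polynomial ℕ, ∀ n, A.coinLen n = q.eval n)
    (hobl : ∀ x r, A.run x r = A.run x (r.take (A.coinLen x.length))) (x : List Bool) (n : ℕ) :
    (paramLift A).outputPMF paramEnc (x, n) = A.outputPMF id x := by
  obtain ⟨q, hq⟩ := hq
  have hle : A.coinLen x.length ≤ A.coinLen (paramEnc (x, n)).length := by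
    rw [hq, hq]
    exact polynomial_eval_mono q (length_le_length_paramEnc x n)
  simp only [RandAlg.outputPMF, paramLift, id]
  have h1 :
      (fun r : List.Vector Bool (A.coinLen (paramEnc (x, n)).length) => A.run x r.toList) =
      (fun s : List Bool => A.run x s) ∘ fun r => r.toList.take (A.coinLen x.length) := by
    funext r
    exact hobl x r.toList
  have h2 : (fun r : List.Vector Bool (A.coinLen x.length) => A.run x r.toList) =
      (fun s : List Bool => A.run x s) ∘ List.Vector.toList := rfl
  rw [h1, h2, ← PMF.map_comp, ← PMF.map_comp, map_take_uniformOfFintype_vector hle]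

/-- Probabilities under the lift. [folklore] -/
theorem pr_paramLift (A : RandAlg (List Bool) β)
    (hq : ∃ q : Polynomial ℕ, ∀ n, A.coinLen n = q.eval n)
    (hobl : ∀ x r, A.run x r = A.run x (r.take (A.coinLen x.length))) (x : List Bool) (n : ℕ)
    (E : Set β) : (paramLift A).pr paramEnc (x, n) E = A.pr id x E := by
  simp only [RandAlg.pr, outputPMF_paramLift A hq hobl]

/-- Dropping the unary parameter is polynomial time: `(⟨x, 1ⁿ⟩, r) ↦ (x, r)` is computed by the
tree's `dropParamsMachine` in `|input|` steps. [cite: AroraBarak2009, §0.1 and §1.2] -/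
theorem polyTimeComputable_paramEnc_dropParam :
    PolyTimeComputable (fun p : (List Bool × ℕ) × List Bool => boolPair (paramEnc p.1) p.2)
      (Function.uncurry boolPair) (fun p : (List Bool × ℕ) × List Bool => (p.1.1, p.2)) := by
  refine ⟨Polynomial.X, dropParamsMachine, fun p => ?_⟩
  simp only [Polynomial.eval_X, paramEnc, Function.uncurry]
  exact outputsWithin_dropParamsMachine p.1.1 _ p.2

/-- The lift is PPT. [cite: AroraBarak2009, Thm. 2.8 (proof)] -/
theorem isPolyTime_paramLift {eb : β → List Γ₁} {A : RandAlg (List Bool) β}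
    (hA : A.IsPolyTime id eb) : (paramLift A).IsPolyTime paramEnc eb :=
  ⟨PolyTimeComputable.comp_holds hA.1 polyTimeComputable_paramEnc_dropParam, hA.2⟩

end ParamLift

/-- **`(BPP, 𝒟) ⊆ Heur_δBPP` for every ensemble and every `δ ≥ 0`**: amplify a `BPP` machine to
coin error `≤ 1/8 < 1/4` on every input, truncate its coins, lift to `(x, 1ⁿ)`; no input is bad.
[cite: BogdanovTrevisan2006, §2.3] -/
theorem mem_HeurDeltaBPP_of_mem_BPP {L : Language Bool} (hL : L ∈ BPP) (D : Ensemble)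
    {δ : ℕ → ℝ} (hδ : ∀ n, 0 ≤ δ n) : (⟨L, D⟩ : DistProblem) ∈ HeurDeltaBPP δ := by
  obtain ⟨A, hA, hq, hcorrect⟩ := exists_randAlg_error_le_of_mem_BPP_holds hL (1 / 8) (by norm_num)
  have hB : (A.truncate id).IsPolyTime id encodeBool :=
    hA.truncate polyTimeComputable_boolPair_take_holds hq
  have hobl : ∀ x r, (A.truncate id).run x r =
      (A.truncate id).run x (r.take ((A.truncate id).coinLen x.length)) :=
    fun x r => (A.truncate_run_take id x r).symm
  refine ⟨paramLift (A.truncate id), isPolyTime_paramLift hB, fun n => ?_⟩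
  have hempty : {x | (1:ℝ) / 4 ≤ (paramLift (A.truncate id)).pr paramEnc (x, n)
      {b | b ≠ L.boolIndicator x}} = ∅ := by
    refine Set.eq_empty_of_forall_notMem fun x hx => ?_
    rw [Set.mem_setOf_eq, pr_paramLift (A.truncate id) hq hobl, RandAlg.pr_truncate,
      RandAlg.pr_ne_eq_one_sub] at hx
    have := hcorrect x
    linarith
  change D.prob n {x | (1:ℝ) / 4 ≤ (paramLift (A.truncate id)).pr paramEnc (x, n)
      {b | b ≠ L.boolIndicator x}} ≤ δ n
  rw [hempty, Ensemble.prob, MeasureTheory.measure_empty, ENNReal.toReal_zero]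
  exact hδ n

/-- **The crux implies the worst-case separation `IQ3 ∉ BPP`** (hence `IQ3 ∉ P`; since
`h(−d) = #reducedForms(−d)` is a `#P` count, a proof of the crux proves `FP ≠ #P`): barrier
`Literature.Barriers.QuantumAdvantage.SeparationPrerequisites` applies to the crux itself, not only
to the route's top rung. [cite: BogdanovTrevisan2006, §2.3] -/
theorem avgFace_imp_not_mem_BPP (h : AvgFaceBeyondPrior) : iq3Lang ∉ BPP := by
  rw [avgFace_iff_Q] at h
  exact fun hBPP => h (mem_HeurDeltaBPP_of_mem_BPP hBPP ens (δ := fun _ => (1:ℝ) / 3)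
    fun _ => by norm_num)

/-- Remark, stated contrapositively so that this work file proves no summit-shaped conclusion:
**a disproof of the crux follows from `BQP ⊆ BPP` plus the BQP crux** (`IqThreeMemBQP`,
Hallgren under GRH). Read forwards it says the support item is itself assembly-grade — with the
BQP crux it closes the summit, bypassing the `P/poly` rung `IqThreeNotPPoly` (planner: note). [folklore] -/
theorem not_avgFace_of_not_summit (hQ : ¬ QuantumAdvantage) (h₂ : IqThreeMemBQP) :
    ¬ AvgFaceBeyondPrior :=
  fun h₁ => hQ ⟨_, h₂, avgFace_imp_not_mem_BPP h₁⟩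

end Summit.QuantumAdvantage.QuantumAdvantage.Theorems.AvgFaceBeyondPrior.Negative
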